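import Summits.CriticalPhenomena.PercolationContinuityZ3.Theorems.Transplant.FKConnectivityAllQAntipodalDictionary
import HarnessLib

/-!
# Connectivity correlation inequalities for `φ_{w,q}`, every `q > 0` — LOOPS IN THE ANTIPODAL SUM: `T_q(F ∪ {ℓ}, ρ) = 2·T_q(F, ρ)`, `T_q(F, ρ ∪ {ℓ}) = T_q(F, ρ)`

Proof file (`--supports stmt-CriticalPhenomena-4575`), census lineage (gen 38) of LANE 2's FK sub-programme; builds on p205010
(kernel theorem, internal audit signed; external expert review pending).  No definitions, no named facts, no sorries.

A diagonal pair `ℓ = s(x,x)` (a loop) never changes an open graph, hence neither a cluster count nor a connection pattern; in census gen 25's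
weight-free antipodal sum `T_q(z,s,t;F,ρ)` (`FK.antipodalT`) a loop in the free set `F` therefore doubles every term (both members of the
antipodal pair `(X, F∖X)` carry it once) and a loop in the contracted set `ρ` changes nothing.  Read through the dictionary
`FK.antipodalT_eq_two_mul_apUpcC` on fk-2's functional `FK.apUpcC`:
* `FK.openGraph_coe_insert_of_isDiag`, `FK.clusterCount_coe_insert_of_isDiag`, `FK.apConn_insert_of_isDiag`, `FK.apAttach_insert_of_isDiag`;
* `FK.apUpcC_attach_insert_left_of_isDiag` (`= 2·…`), `FK.apUpcC_attach_insert_right_of_isDiag` (`= …`);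
* **`FK.antipodalT_insert_left_of_isDiag`**, **`FK.antipodalT_insert_right_of_isDiag`**, and the consequence
  **`FK.antipodalT_nonneg_iff_eraseDiag`**-type transfer `FK.antipodalT_nonneg_of_nonneg_filter`: `T_q` on `(F, ρ)` is `≥ 0` as soon as
  it is on the loop-free parts `(F.filter (¬·.IsDiag), ρ.filter (¬·.IsDiag))`.
Use: statements about `T_q ≥ 0` on a class of SUPPORT GRAPHS (`SimpleGraph.fromEdgeSet`, which ignores loops) reduce to loop-free edge sets
(census g38's `…Pat3NoK4Minor.lean`). [cite: Grimmett2006, §1.4 eq. (1.20) (p. 15)] [cite: AyyerLinussonRavichandran2025, §7 (p. 22)]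
-/

noncomputable section

namespace Summit.CriticalPhenomena.PercolationContinuityZ3.Theorems

namespace FK

open SimpleGraph Literature.Probability.LatticeModels Literature.Probability.Percolation
open scoped Classical

variable {V : Type*}

/-! ### A loop changes no open graph -/

/-- Inserting a diagonal pair into a finite edge set does not change the open graph. [folklore] -/
theorem openGraph_coe_insert_of_isDiag {ℓ : Sym2 V} (hℓ : ℓ.IsDiag) (γ : Finset (Sym2 V)) :
    openGraph (↑(insert ℓ γ) : BondConfig V) = openGraph (↑γ : BondConfig V) := by
  ext a b
  simp only [openGraph, SimpleGraph.fromEdgeSet_adj, Finset.coe_insert, Set.mem_insert_iff, Finset.mem_coe]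
  constructor
  · rintro ⟨h | h, hab⟩
    · exact absurd (h ▸ hℓ : (s(a, b)).IsDiag) (by rwa [Sym2.mk_isDiag_iff])
    · exact ⟨h, hab⟩
  · rintro ⟨h, hab⟩
    exact ⟨Or.inr h, hab⟩

/-- A loop does not change the free cluster count. [cite: Grimmett2006, §1.4 eq. (1.20) (p. 15)] -/
theorem clusterCount_coe_insert_of_isDiag [Fintype V] {ℓ : Sym2 V} (hℓ : ℓ.IsDiag) (γ : Finset (Sym2 V)) :
    clusterCount (↑(insert ℓ γ) : BondConfig V) ∅ = clusterCount (↑γ : BondConfig V) ∅ := by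
  unfold clusterCount
  rw [openGraph_coe_insert_of_isDiag hℓ]

/-- A loop does not change the connection indicator. [folklore] -/
theorem apConn_insert_of_isDiag [Fintype V] {ℓ : Sym2 V} (hℓ : ℓ.IsDiag) (γ : Finset (Sym2 V)) (s t : V) :
    apConn (insert ℓ γ) s t = apConn γ s t := by
  unfold apConn
  rw [openGraph_coe_insert_of_isDiag hℓ]

/-- A loop does not change the attachment indicator. [folklore] -/
theorem apAttach_insert_of_isDiag [Fintype V] {ℓ : Sym2 V} (hℓ : ℓ.IsDiag) (γ : Finset (Sym2 V)) (z s t : V) :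
    apAttach (insert ℓ γ) z s t = apAttach γ z s t := by
  unfold apAttach
  rw [openGraph_coe_insert_of_isDiag hℓ]

variable [Fintype V]

/-! ### A loop in the contracted set -/

/-- The minor exponent with a loop added to the contracted set. [folklore] -/
theorem apExpC_insert_right_of_isDiag {ℓ : Sym2 V} (hℓ : ℓ.IsDiag) (E C γ : Finset (Sym2 V)) :
    apExpC E (insert ℓ C) γ = apExpC E C γ := by
  unfold apExpC
  rw [Finset.union_insert, Finset.union_insert, clusterCount_coe_insert_of_isDiag hℓ, clusterCount_coe_insert_of_isDiag hℓ]

/-- **A loop in the contracted set changes nothing**: `apUpcC q E (insert ℓ C) s t (γ ↦ apAttach (γ ∪ insert ℓ C)) = apUpcC q E C s t (γ ↦ apAttach (γ ∪ C))`.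
[cite: Grimmett2006, §1.4 eq. (1.20) (p. 15)] -/
theorem apUpcC_attach_insert_right_of_isDiag (q : ℝ) {ℓ : Sym2 V} (hℓ : ℓ.IsDiag) (E C : Finset (Sym2 V)) (z s t : V) :
    apUpcC q E (insert ℓ C) s t (fun γ => apAttach (γ ∪ insert ℓ C) z s t) =
      apUpcC q E C s t (fun γ => apAttach (γ ∪ C) z s t) := by
  unfold apUpcC
  refine Finset.sum_congr rfl fun γ _ => ?_
  dsimp only
  rw [apExpC_insert_right_of_isDiag hℓ, Finset.union_insert, Finset.union_insert,
    apConn_insert_of_isDiag hℓ, apConn_insert_of_isDiag hℓ, apAttach_insert_of_isDiag hℓ]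

/-! ### A loop in the free set -/

/-- **A loop in the free set doubles the functional**: for `ℓ ∉ E` diagonal,
`apUpcC q (insert ℓ E) C s t (γ ↦ apAttach (γ ∪ C)) = 2 · apUpcC q E C s t (γ ↦ apAttach (γ ∪ C))`.
[cite: Grimmett2006, §1.4 eq. (1.20) (p. 15)] -/
theorem apUpcC_attach_insert_left_of_isDiag (q : ℝ) {ℓ : Sym2 V} (hℓ : ℓ.IsDiag) {E : Finset (Sym2 V)} (hℓE : ℓ ∉ E)
    (C : Finset (Sym2 V)) (z s t : V) :
    apUpcC q (insert ℓ E) C s t (fun γ => apAttach (γ ∪ C) z s t) =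
      2 * apUpcC q E C s t (fun γ => apAttach (γ ∪ C) z s t) := by
  unfold apUpcC
  rw [Finset.sum_powerset_insert hℓE, two_mul]
  congr 1
  · refine Finset.sum_congr rfl fun γ hγ => ?_
    have hγE : γ ⊆ E := Finset.mem_powerset.1 hγ
    have hℓγ : ℓ ∉ γ := fun h => hℓE (hγE h)
    have e1 : insert ℓ E \ γ = insert ℓ (E \ γ) := Finset.insert_sdiff_of_notMem E hℓγ
    dsimp only
    unfold apExpC
    rw [e1, Finset.union_comm (insert ℓ (E \ γ)) C, Finset.union_insert, clusterCount_coe_insert_of_isDiag hℓ,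
      apConn_insert_of_isDiag hℓ, Finset.union_comm C (E \ γ)]
  · refine Finset.sum_congr rfl fun γ hγ => ?_
    have hγE : γ ⊆ E := Finset.mem_powerset.1 hγ
    have hℓγ : ℓ ∉ γ := fun h => hℓE (hγE h)
    have e2 : insert ℓ E \ insert ℓ γ = E \ γ := by
      rw [Finset.insert_sdiff_insert, Finset.sdiff_insert_of_notMem hℓE]
    dsimp only
    unfold apExpC
    rw [e2, Finset.union_comm (insert ℓ γ) C, Finset.union_insert, clusterCount_coe_insert_of_isDiag hℓ,
      apConn_insert_of_isDiag hℓ, apAttach_insert_of_isDiag hℓ, Finset.union_comm C γ]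

/-! ### The antipodal sum -/

/-- **`T_q(z,s,t; F, ρ ∪ {ℓ}) = T_q(z,s,t; F, ρ)`** for a loop `ℓ`. [cite: AyyerLinussonRavichandran2025, §7 (p. 22)] -/
theorem antipodalT_insert_right_of_isDiag (q : ℝ) {ℓ : Sym2 V} (hℓ : ℓ.IsDiag) (z s t : V) (F C : Finset (Sym2 V)) :
    antipodalT q z s t (↑F : BondConfig V) (↑(insert ℓ C) : BondConfig V) = antipodalT q z s t (↑F : BondConfig V) (↑C : BondConfig V) := by
  rw [antipodalT_eq_two_mul_apUpcC, antipodalT_eq_two_mul_apUpcC, apUpcC_attach_insert_right_of_isDiag q hℓ]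

/-- **`T_q(z,s,t; F ∪ {ℓ}, ρ) = 2·T_q(z,s,t; F, ρ)`** for a loop `ℓ ∉ F`. [cite: AyyerLinussonRavichandran2025, §7 (p. 22)] -/
theorem antipodalT_insert_left_of_isDiag (q : ℝ) {ℓ : Sym2 V} (hℓ : ℓ.IsDiag) (z s t : V) {F : Finset (Sym2 V)} (hℓF : ℓ ∉ F)
    (C : Finset (Sym2 V)) :
    antipodalT q z s t (↑(insert ℓ F) : BondConfig V) (↑C : BondConfig V) = 2 * antipodalT q z s t (↑F : BondConfig V) (↑C : BondConfig V) := by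
  rw [antipodalT_eq_two_mul_apUpcC, antipodalT_eq_two_mul_apUpcC, apUpcC_attach_insert_left_of_isDiag q hℓ hℓF, mul_left_comm]

/-- **Loops are irrelevant to the sign of `T_q`**: if `T_q(z,s,t; F°, C°) ≥ 0` for the loop-free parts `F° = {e ∈ F | ¬ e.IsDiag}`,
`C° = {e ∈ C | ¬ e.IsDiag}`, then `T_q(z,s,t; F, C) ≥ 0`. [cite: AyyerLinussonRavichandran2025, §7 (p. 22)] -/
theorem antipodalT_nonneg_of_nonneg_filter (q : ℝ) (z s t : V) (F C : Finset (Sym2 V))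
    (h : 0 ≤ antipodalT q z s t (↑(F.filter fun e => ¬ e.IsDiag) : BondConfig V) (↑(C.filter fun e => ¬ e.IsDiag) : BondConfig V)) :
    0 ≤ antipodalT q z s t (↑F : BondConfig V) (↑C : BondConfig V) := by
  -- peel the loops of `F`, then those of `C`, by induction on the number of loops
  have keyF : ∀ (n : ℕ) (F C : Finset (Sym2 V)), (F.filter fun e => e.IsDiag).card = n →
      0 ≤ antipodalT q z s t (↑(F.filter fun e => ¬ e.IsDiag) : BondConfig V) (↑C : BondConfig V) →
      0 ≤ antipodalT q z s t (↑F : BondConfig V) (↑C : BondConfig V) := by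
    intro n
    induction n with
    | zero =>
      intro F C hn h0
      have hF : (F.filter fun e => ¬ e.IsDiag) = F := by
        refine Finset.filter_true_of_mem fun e he hed => ?_
        have : e ∈ F.filter fun e => e.IsDiag := Finset.mem_filter.2 ⟨he, hed⟩
        rw [Finset.card_eq_zero.1 hn] at this
        exact Finset.notMem_empty e this
      rwa [hF] at h0
    | succ n ih =>
      intro F C hn h0
      obtain ⟨ℓ, hℓ⟩ : (F.filter fun e => e.IsDiag).Nonempty := by
        rw [← Finset.card_pos, hn]; exact Nat.succ_pos n
      have hℓF : ℓ ∈ F := (Finset.mem_filter.1 hℓ).1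
      have hℓd : ℓ.IsDiag := (Finset.mem_filter.1 hℓ).2
      have hFe : F = insert ℓ (F.erase ℓ) := (Finset.insert_erase hℓF).symm
      have hcard : ((F.erase ℓ).filter fun e => e.IsDiag).card = n := by
        rw [Finset.filter_erase, Finset.card_erase_of_mem hℓ, hn]; rfl
      have hsame : ((F.erase ℓ).filter fun e => ¬ e.IsDiag) = (F.filter fun e => ¬ e.IsDiag) := by
        rw [Finset.filter_erase, Finset.erase_eq_of_notMem]
        exact fun hmem => (Finset.mem_filter.1 hmem).2 hℓd
      have ih' := ih (F.erase ℓ) C hcard (by rw [hsame]; exact h0)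
      rw [hFe, antipodalT_insert_left_of_isDiag q hℓd z s t (Finset.notMem_erase ℓ F) C]
      exact mul_nonneg (by norm_num) ih'
  have keyC : ∀ (n : ℕ) (F C : Finset (Sym2 V)), (C.filter fun e => e.IsDiag).card = n →
      antipodalT q z s t (↑F : BondConfig V) (↑C : BondConfig V) =
        antipodalT q z s t (↑F : BondConfig V) (↑(C.filter fun e => ¬ e.IsDiag) : BondConfig V) := by
    intro n
    induction n with
    | zero =>
      intro F C hn
      have hC : (C.filter fun e => ¬ e.IsDiag) = C := by
        refine Finset.filter_true_of_mem fun e he hed => ?_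
        have : e ∈ C.filter fun e => e.IsDiag := Finset.mem_filter.2 ⟨he, hed⟩
        rw [Finset.card_eq_zero.1 hn] at this
        exact Finset.notMem_empty e this
      rw [hC]
    | succ n ih =>
      intro F C hn
      obtain ⟨ℓ, hℓ⟩ : (C.filter fun e => e.IsDiag).Nonempty := by
        rw [← Finset.card_pos, hn]; exact Nat.succ_pos n
      have hℓC : ℓ ∈ C := (Finset.mem_filter.1 hℓ).1
      have hℓd : ℓ.IsDiag := (Finset.mem_filter.1 hℓ).2
      have hCe : C = insert ℓ (C.erase ℓ) := (Finset.insert_erase hℓC).symm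
      have hcard : ((C.erase ℓ).filter fun e => e.IsDiag).card = n := by
        rw [Finset.filter_erase, Finset.card_erase_of_mem hℓ, hn]; rfl
      have hsame : ((C.erase ℓ).filter fun e => ¬ e.IsDiag) = (C.filter fun e => ¬ e.IsDiag) := by
        rw [Finset.filter_erase, Finset.erase_eq_of_notMem]
        exact fun hmem => (Finset.mem_filter.1 hmem).2 hℓd
      conv_lhs => rw [hCe, antipodalT_insert_right_of_isDiag q hℓd z s t F (C.erase ℓ)]
      rw [ih F (C.erase ℓ) hcard, hsame]
  refine keyF _ F C rfl ?_
  rw [keyC _ (F.filter fun e => ¬ e.IsDiag) C rfl]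
  exact h

end FK

end Summit.CriticalPhenomena.PercolationContinuityZ3.Theorems

end
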